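import Mathlib
import Summits.AtomisticToContinuum.Crystallization.Theses.PhononSlackCertificates
import Summits.AtomisticToContinuum.Crystallization.Theorems.PhononSlackCertificatesAllBadGapFloor

/-!
# Route `PhononSlackCertificates`, crux `NearFieldConvexity` (stmt-AtomisticToContinuum-13958), line `Sketch`:
stub `stub_transfer`

The bookkeeping transfer C+ (pointwise calibrated near field) => NearFieldConvexity (unfolded), card frame-free-star-certificate.
-/

noncomputable section

open scoped BigOperators InnerProductSpace Matrix ComplexOrder
open Literature.MathematicalPhysics.StatisticalMechanics Literature.Geometry.DiscreteGeometry

namespace Summit.AtomisticToContinuum.Crystallization.Theorems.PhononSlackNearFieldConvexity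

/-- Counting: the subtype `{i // i ∈ Ω ∧ p i}` has `#(Ω.filter p)` elements. -/
private theorem transfer_natCard_eq {ι : Type*} (Ω : Finset ι) (p : ι → Prop) [DecidablePred p] :
    Nat.card {i // i ∈ Ω ∧ p i} = (Ω.filter p).card := by
  have e : {i // i ∈ Ω ∧ p i} ≃ {i // i ∈ Ω.filter p} :=
    Equiv.subtypeEquivRight fun i => Finset.mem_filter.symm
  rw [Nat.card_congr e, Nat.card_eq_finsetCard]

/-- **Abstract bookkeeping.**  On a finite index type: `Ω` a region, `I ⊆ Ω` its interior,
`B = Ω ∖ I` its boundary, `Ic = Iᶜ`; an antisymmetric transfer `τ`, a slack `g`, site excesses `E`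
with the calibrated pointwise bound on `I` (`0 ≤ E + Σ τ + g`, and `c ≤ …` at non-layered sites),
the flux/slack budget `Σ_I (g + Σ_{Ic} |τ|) ≤ C·#B` and the floor `−L ≤ E`; then
`c·#(Ω ∩ NL) − (C + L + c)·#B ≤ Σ_Ω E` (internal transfers cancel by antisymmetry). -/
private theorem transfer_bookkeeping {ι : Type*} [Fintype ι] (NL : ι → Prop) [DecidablePred NL]
    (E g : ι → ℝ) (τ : ι → ι → ℝ) (Ω I Ic B : Finset ι) {c C L : ℝ} (hc : 0 < c)
    (hτ : ∀ i j, τ i j = -τ j i) (hI : I ⊆ Ω) (hB : ∀ i, i ∈ B ↔ i ∈ Ω ∧ i ∉ I)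
    (hIc : ∀ j, j ∈ Ic ↔ j ∉ I)
    (hpt : ∀ i ∈ I, 0 ≤ E i + (∑ j, τ i j) + g i ∧ (NL i → c ≤ E i + (∑ j, τ i j) + g i))
    (hflux : ∑ i ∈ I, (g i + ∑ j ∈ Ic, |τ i j|) ≤ C * (B.card : ℝ))
    (hbdry : ∀ i, -L ≤ E i) :
    c * ((Ω.filter NL).card : ℝ) - (C + L + c) * (B.card : ℝ) ≤ ∑ i ∈ Ω, E i := by
  classical
  -- split the region into interior and boundary
  have hΩsplit : ∑ i ∈ Ω, E i = ∑ i ∈ I, E i + ∑ i ∈ B, E i := by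
    rw [← Finset.sum_filter_add_sum_filter_not Ω (fun i => i ∈ I)]
    congr 1
    · congr 1
      ext i
      simp only [Finset.mem_filter]
      exact ⟨fun h => h.2, fun h => ⟨hI h, h⟩⟩
    · congr 1
      ext i
      rw [Finset.mem_filter, hB]
  -- interior: the calibrated pointwise bound, summed
  have hint : ∑ i ∈ I, (if NL i then c else 0) ≤ ∑ i ∈ I, (E i + (∑ j, τ i j) + g i) := by
    refine Finset.sum_le_sum fun i hi => ?_
    obtain ⟨h0, h1⟩ := hpt i hi
    split_ifs with h
    · exact h1 h
    · exact h0
  have hind : ∑ i ∈ I, (if NL i then c else 0) = c * ((I.filter NL).card : ℝ) := by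
    rw [Finset.sum_ite, Finset.sum_const_zero, add_zero, Finset.sum_const, nsmul_eq_mul, mul_comm]
  -- internal transfers cancel
  have hanti : ∑ i ∈ I, ∑ j ∈ I, τ i j = 0 := by
    have h := Finset.sum_comm (s := I) (t := I) (f := τ)
    have h2 : ∑ j ∈ I, ∑ i ∈ I, τ i j = -∑ j ∈ I, ∑ i ∈ I, τ j i := by
      rw [← Finset.sum_neg_distrib]
      refine Finset.sum_congr rfl fun j _ => ?_
      rw [← Finset.sum_neg_distrib]
      exact Finset.sum_congr rfl fun i _ => hτ i j
    linarith
  have hsplitj : ∀ i, ∑ j, τ i j = ∑ j ∈ I, τ i j + ∑ j ∈ Ic, τ i j := by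
    intro i
    rw [← Finset.sum_filter_add_sum_filter_not Finset.univ (fun j => j ∈ I)]
    congr 1
    · congr 1
      ext j
      simp
    · congr 1
      ext j
      simp [hIc]
  -- flux and slack are paid by the budget
  have hflux' : ∑ i ∈ I, ((∑ j, τ i j) + g i) ≤ C * (B.card : ℝ) := by
    calc ∑ i ∈ I, ((∑ j, τ i j) + g i)
          = ∑ i ∈ I, ∑ j ∈ I, τ i j + ∑ i ∈ I, (∑ j ∈ Ic, τ i j + g i) := by
          rw [← Finset.sum_add_distrib]
          refine Finset.sum_congr rfl fun i _ => ?_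
          rw [hsplitj i]
          ring
      _ = ∑ i ∈ I, (∑ j ∈ Ic, τ i j + g i) := by rw [hanti, zero_add]
      _ ≤ ∑ i ∈ I, (g i + ∑ j ∈ Ic, |τ i j|) := by
          refine Finset.sum_le_sum fun i _ => ?_
          have : ∑ j ∈ Ic, τ i j ≤ ∑ j ∈ Ic, |τ i j| :=
            Finset.sum_le_sum fun j _ => le_abs_self _
          linarith
      _ ≤ C * (B.card : ℝ) := hflux
  have hIsum : c * ((I.filter NL).card : ℝ) - C * (B.card : ℝ) ≤ ∑ i ∈ I, E i := by
    have h1 : ∑ i ∈ I, (E i + (∑ j, τ i j) + g i) =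
        ∑ i ∈ I, E i + ∑ i ∈ I, ((∑ j, τ i j) + g i) := by
      rw [← Finset.sum_add_distrib]
      exact Finset.sum_congr rfl fun i _ => add_assoc _ _ _
    rw [hind, h1] at hint
    linarith
  -- boundary: the floor
  have hBsum : -L * (B.card : ℝ) ≤ ∑ i ∈ B, E i := by
    have h : ∑ _i ∈ B, (-L) ≤ ∑ i ∈ B, E i := Finset.sum_le_sum fun i _ => hbdry i
    rwa [Finset.sum_const, nsmul_eq_mul, mul_comm] at h
  -- counting the non-layered sites
  have hcount : ((Ω.filter NL).card : ℝ) ≤ ((I.filter NL).card : ℝ) + (B.card : ℝ) := by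
    have h : Ω.filter NL ⊆ I.filter NL ∪ B := by
      intro i hi
      rw [Finset.mem_filter] at hi
      rw [Finset.mem_union, Finset.mem_filter, hB]
      by_cases hiI : i ∈ I
      · exact Or.inl ⟨hiI, hi.2⟩
      · exact Or.inr ⟨hi.1, hiI⟩
    exact_mod_cast (Finset.card_le_card h).trans (Finset.card_union_le _ _)
  have hmono := mul_le_mul_of_nonneg_left hcount hc.le
  rw [hΩsplit]
  nlinarith [hmono, hIsum, hBsum, hflux']

/-- **Stub (card C, bookkeeping): C⁺ ⇒ the crux BY NAME.**  Interior sites (closed 4-ball inside `Ω`,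
hence good) are summed with (i); `Σ_{i,j ∈ int Ω} τ i j = 0` by antisymmetry; the flux to `j ∉ int Ω`
and the slack are paid by (ii); boundary sites `i ∈ Ω ∖ int Ω = ∂₄Ω` cost
`(e_i − e*) ≥ −(250/12)·δ⁻⁶` (`neg_le_siteEnergy_of_separated`, `eStar_le_neg_half`); finally
`#NL(Ω) ≤ Σ_{int Ω} 𝟙[NL] + #∂₄Ω`.  Constants: `c := c`, `C := C + (250/12) δ⁻⁶ + c`. -/
theorem stub_transfer
    (h : ∀ δ : ℝ, 0 < δ → ∀ η : ℝ, 0 < η → ∃ c : ℝ, 0 < c ∧ ∃ C : ℝ, ∀ (N : ℕ) (x : Fin N → EuclideanSpace ℝ (Fin 3)),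
        (∀ i j : Fin N, i ≠ j → δ ≤ dist (x i) (x j)) →
        ∃ (τ : Fin N → Fin N → ℝ) (g : Fin N → ℝ), (∀ i j, τ i j = -τ j i) ∧ (∀ i, 0 ≤ g i) ∧
          (∀ i : Fin N, (∀ j : Fin N, dist (x j) (x i) ≤ 4 → IsTwoShellGood (1 / 20) (47 / 50) 1 x j) →
            0 ≤ ((1 / 2 : ℝ) * (∑ j ∈ Finset.univ.erase i, lennardJones (dist (x i) (x j))) - (⨅ Q : PeriodicConfiguration 3, Q.energyPerParticle lennardJones)) + (∑ j, τ i j) + g i ∧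
            (¬ (∃ (A : EuclideanSpace ℝ (Fin 3) →ₗᵢ[ℝ] EuclideanSpace ℝ (Fin 3)) (t : EuclideanSpace ℝ (Fin 3)) (a : ℝ) (s : ℤ → ℤ) (z : ℤ → ℝ), 47 / 50 ≤ a ∧ a ≤ 1 ∧ IsHaggSeq s ∧ (∀ m : ℤ, 39 / 50 * a ≤ z (m + 1) - z m ∧ z (m + 1) - z m ≤ 17 / 20 * a) ∧ (fun S : Set (EuclideanSpace ℝ (Fin 3)) => (∀ j : Fin N, dist (x j) (x i) ≤ 2 → ∃ p ∈ S, dist (x j + t) p ≤ η) ∧ (∀ p ∈ S, dist p (x i + t) ≤ 2 → ∃ j : Fin N, dist (x j + t) p ≤ η)) {p | ∃ m i j : ℤ, p = A (((i : ℝ) • triangularVec₁ a) + ((j : ℝ) • triangularVec₂ a) + ((haggLabel s m : ℝ) • barlowOffset a) + (z m • layerNormal 1))}) →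
              c ≤ ((1 / 2 : ℝ) * (∑ j ∈ Finset.univ.erase i, lennardJones (dist (x i) (x j))) - (⨅ Q : PeriodicConfiguration 3, Q.energyPerParticle lennardJones)) + (∑ j, τ i j) + g i)) ∧
          (∀ Ω : Finset (Fin N), (∀ i ∈ Ω, IsTwoShellGood (1 / 20) (47 / 50) 1 x i) →
            (∑ i ∈ Ω.filter (fun i => ∀ j : Fin N, dist (x j) (x i) ≤ 4 → j ∈ Ω),
                (g i + ∑ j ∈ Finset.univ.filter (fun j => ¬ (j ∈ Ω ∧ ∀ k : Fin N, dist (x k) (x j) ≤ 4 → k ∈ Ω)),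
                  |τ i j|)) ≤
              C * (Nat.card {i : Fin N // i ∈ Ω ∧ ∃ j : Fin N, j ∉ Ω ∧ dist (x j) (x i) ≤ 4} : ℝ))) :
    ∀ δ : ℝ, 0 < δ → ∀ η : ℝ, 0 < η → ∃ c : ℝ, 0 < c ∧ ∃ C : ℝ, ∀ (N : ℕ) (x : Fin N → EuclideanSpace ℝ (Fin 3)), (∀ i j : Fin N, i ≠ j → δ ≤ dist (x i) (x j)) → ∀ Ω : Finset (Fin N), (∀ i ∈ Ω, IsTwoShellGood (1 / 20) (47 / 50) 1 x i) → c * (Nat.card {i : Fin N // i ∈ Ω ∧ ¬ (∃ (A : EuclideanSpace ℝ (Fin 3) →ₗᵢ[ℝ] EuclideanSpace ℝ (Fin 3)) (t : EuclideanSpace ℝ (Fin 3)) (a : ℝ) (s : ℤ → ℤ) (z : ℤ → ℝ), 47 / 50 ≤ a ∧ a ≤ 1 ∧ IsHaggSeq s ∧ (∀ m : ℤ, 39 / 50 * a ≤ z (m + 1) - z m ∧ z (m + 1) - z m ≤ 17 / 20 * a) ∧ (fun S : Set (EuclideanSpace ℝ (Fin 3)) => (∀ j : Fin N, dist (x j)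 (x i) ≤ 2 → ∃ p ∈ S, dist (x j + t) p ≤ η) ∧ (∀ p ∈ S, dist p (x i + t) ≤ 2 → ∃ j : Fin N, dist (x j + t) p ≤ η)) {p | ∃ m i j : ℤ, p = A (((i : ℝ) • triangularVec₁ a) + ((j : ℝ) • triangularVec₂ a) + ((haggLabel s m : ℝ) • barlowOffset a) + (z m • layerNormal 1))})} : ℝ) - C * (Nat.card {i : Fin N // i ∈ Ω ∧ ∃ j : Fin N, j ∉ Ω ∧ dist (x j) (x i) ≤ 4} : ℝ) ≤ ∑ i ∈ Ω, ((1 / 2 : ℝ) * (∑ j ∈ Finset.univ.erase i, lennardJones (dist (x i) (x j))) - (⨅ Q : PeriodicConfiguration 3, Q.energyPerParticle lennardJones)) := by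
  intro δ hδ η hη
  obtain ⟨c, hc, C, hC⟩ := h δ hδ η hη
  refine ⟨c, hc, C + 250 / 12 * δ⁻¹ ^ 6 + c, ?_⟩
  intro N x hsep Ω hΩ
  obtain ⟨τ, g, hτ, -, hpt, hflux⟩ := hC N x hsep
  classical
  -- interior, exterior-of-interior and boundary of `Ω`
  set I : Finset (Fin N) := Ω.filter (fun i => ∀ j : Fin N, dist (x j) (x i) ≤ 4 → j ∈ Ω) with hIdef
  set Ic : Finset (Fin N) :=
    Finset.univ.filter (fun j => ¬ (j ∈ Ω ∧ ∀ k : Fin N, dist (x k) (x j) ≤ 4 → k ∈ Ω)) with hIcdef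
  set B : Finset (Fin N) := Ω.filter (fun i => ∃ j : Fin N, j ∉ Ω ∧ dist (x j) (x i) ≤ 4) with hBdef
  have hflux' := hflux Ω hΩ
  rw [transfer_natCard_eq] at hflux'
  rw [transfer_natCard_eq, transfer_natCard_eq]
  have hIΩ : I ⊆ Ω := Finset.filter_subset _ _
  have hBmem : ∀ i, i ∈ B ↔ i ∈ Ω ∧ i ∉ I := by
    intro i
    simp only [hBdef, hIdef, Finset.mem_filter]
    constructor
    · rintro ⟨hi, j, hj, hd⟩
      exact ⟨hi, fun h' => hj (h'.2 j hd)⟩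
    · rintro ⟨hi, h'⟩
      refine ⟨hi, ?_⟩
      by_contra hne
      exact h' ⟨hi, fun j hd => by_contra fun hj => hne ⟨j, hj, hd⟩⟩
  have hIcmem : ∀ j, j ∈ Ic ↔ j ∉ I := by
    intro j
    simp only [hIcdef, hIdef, Finset.mem_filter, Finset.mem_univ, true_and]
  refine transfer_bookkeeping _ _ g τ Ω I Ic B hc hτ hIΩ hBmem hIcmem ?_ hflux' ?_
  · intro i hi
    exact hpt i fun j hd => hΩ j ((Finset.mem_filter.1 hi).2 j hd)
  · intro i
    have h1 : -(250 / 6 * δ⁻¹ ^ 6) ≤ ∑ j ∈ Finset.univ.erase i, lennardJones (dist (x i) (x j)) :=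
      Summit.AtomisticToContinuum.Crystallization.Theorems.PhononSlackCertificatesAllBadGapFloor.neg_le_siteEnergy_of_separated
        x hδ hsep i
    have h2 : (⨅ Q : PeriodicConfiguration 3, Q.energyPerParticle lennardJones) ≤ -1 / 2 :=
      Summit.AtomisticToContinuum.Crystallization.Theorems.LayeredLawsSelectHcp.Negative.Threshold.eStar_le_neg_half
    linarith

end Summit.AtomisticToContinuum.Crystallization.Theorems.PhononSlackNearFieldConvexity
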